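import Summits.Schanuel.Schanuel.Theorems.ZilberEacEllipticBaseExample
import Summits.Schanuel.Schanuel.Theorems.ZilberEacCurveGraphFibreCase
import Summits.Schanuel.Schanuel.Theorems.ZilberEacParamRamifiedChart
import HarnessLib

/-!
# Arbitrary base branches, XIIIa: BASE CURVES OF EVERY GENUS — the algebra and the analytic branch
# at infinity of `x₁² − P(x₀)x₁ − 1 = 0`

HONEST FRAMING.  Cell `pub-schanuel` (Zilber's Exponential-Algebraic Closedness, case ladder;
host summit Schanuel), seat 2, gen 28.  File VII decided one surface over the genus-one curve
`x₁² − x₀²x₁ = 1`.  Here, for EVERY `P ∈ ℂ[X]` of degree `d ≥ 2` and every `θ ≠ 0`: the base curve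
`C_P : x₁² − P(x₀)x₁ − 1 = 0` is birational to `w² = P(x₀)² + 4` (a hyperelliptic curve of genus
`d − 1` whenever `P² + 4` has no repeated root — e.g. `P = X^d`: `X^{2d} + 4`), and the surface
  `S(P, θ) = {x₁² − P(x₀)x₁ − 1 = 0, y₀ = x₁ − P(x₀) + θ}`   (`y₀ = θ + 1/x₁` on `C_P`)
is in Mantova–Masser's case (dim-π-S-1-free) AND has Zariski-dense exponential points
(**`unprojectedDensityQuestion_hyperellipticFamily`**, file XIIIb; this file: the irreducibility of
the base and fibre relations and the analytic branch).  Branch at infinity `x₀ = 1/s`,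
`x₁ = Φ(s)s^{−d}` with `Φ = U₀(1 + √(1 + 4s^{2d}/U₀²))/2`, `P(1/s) = U₀(s)s^{−d}` (`k = 1 < M = d`),
`y₀ = θ + 2s^d/(U₀(1 + √…)) → θ`; fibre relation `(y₀ − θ)² + P(x₀)(y₀ − θ) − 1` (discriminant
`P² + 4`, not a square), zero branch by Newton–Puiseux; not a line: `L² − PL − 1` cannot vanish for
`deg L ≤ 1`.  So the transcendence method decides instances of Mantova–Masser's question over base
curves of ARBITRARILY LARGE GENUS.  The question stays OPEN in general; EC(3,2) OPEN; NOT
Schanuel's conjecture (neither used nor implied); EAC ⇏ SC.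
-/

noncomputable section

open Filter Topology Set Complex MvPolynomial
open Literature.NumberTheory.Transcendental Literature.ModelTheory.Zilber
open Literature.ModelTheory.ExponentialFields

set_option linter.dupNamespace false

namespace Summit.Schanuel.Schanuel.Theorems

section Family

variable (P : Polynomial ℂ) (θ : ℂ)

/-! ## Part A. Algebra -/

/-- `P² + 4` is not a square in `ℂ[X]` for non-constant `P` (`(r − P)(r + P) = 4`). [folklore] -/
theorem sq_add_four_ne_sq (hP : 1 ≤ P.natDegree) (r : Polynomial ℂ) : P ^ 2 + 4 ≠ r ^ 2 := by
  intro h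
  have hprod : (r - P) * (r + P) = Polynomial.C 4 := by
    have e : (r - P) * (r + P) = r ^ 2 - P ^ 2 := by ring
    rw [e, ← h]
    simp [map_ofNat]
  have h4 : (Polynomial.C (4 : ℂ)) ≠ 0 := by
    rw [Ne, Polynomial.C_eq_zero]; norm_num
  have hne₁ : r - P ≠ 0 := by
    intro h0; rw [h0, zero_mul] at hprod; exact h4 hprod.symm
  have hne₂ : r + P ≠ 0 := by
    intro h0; rw [h0, mul_zero] at hprod; exact h4 hprod.symm
  have hdeg := congrArg Polynomial.natDegree hprod
  rw [Polynomial.natDegree_mul hne₁ hne₂, Polynomial.natDegree_C] at hdeg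
  have hd₁ : (r - P).natDegree = 0 := by omega
  have hd₂ : (r + P).natDegree = 0 := by omega
  obtain ⟨a, ha⟩ := Polynomial.natDegree_eq_zero.1 hd₁
  obtain ⟨b, hb⟩ := Polynomial.natDegree_eq_zero.1 hd₂
  have hP2 : (2 : Polynomial ℂ) * P = Polynomial.C (b - a) := by
    rw [map_sub, hb, ha]; ring
  have hdeg2 := congrArg Polynomial.natDegree hP2
  rw [Polynomial.natDegree_C, show (2 : Polynomial ℂ) = Polynomial.C 2 by simp [map_ofNat],
    Polynomial.natDegree_C_mul (two_ne_zero' ℂ)] at hdeg2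
  omega

/-- The base relation `t² − P(s)t − 1` is irreducible in `ℂ[s][t]` for non-constant `P`. [folklore] -/
theorem irreducible_hyperellipticFamily_baseRow (hP : 1 ≤ P.natDegree) :
    Irreducible (Polynomial.C (1 : Polynomial ℂ) * Polynomial.X ^ 2 +
      Polynomial.C (-P : Polynomial ℂ) * Polynomial.X + Polynomial.C (-1 : Polynomial ℂ)) := by
  refine irreducible_quadratic_of_disc_ne_sq one_ne_zero isCoprime_one_left fun r => ?_
  have e : (-P : Polynomial ℂ) ^ 2 - 4 * 1 * (-1) = P ^ 2 + 4 := by ring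
  rw [e]
  exact sq_add_four_ne_sq P hP r

/-- The fibre relation `t² + (P(s) − 2θ)t + (θ² − θP(s) − 1)` is irreducible in `ℂ[s][t]` for
non-constant `P` (discriminant `P² + 4`). [folklore] -/
theorem irreducible_hyperellipticFamily_fibreRow (hP : 1 ≤ P.natDegree) :
    Irreducible (Polynomial.C (1 : Polynomial ℂ) * Polynomial.X ^ 2 +
      Polynomial.C (P - Polynomial.C (2 * θ) : Polynomial ℂ) * Polynomial.X +
      Polynomial.C (Polynomial.C (θ ^ 2) - Polynomial.C θ * P - 1 : Polynomial ℂ)) := by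
  refine irreducible_quadratic_of_disc_ne_sq one_ne_zero isCoprime_one_left fun r => ?_
  have e : (P - Polynomial.C (2 * θ) : Polynomial ℂ) ^ 2 -
      4 * 1 * (Polynomial.C (θ ^ 2) - Polynomial.C θ * P - 1) = P ^ 2 + 4 := by
    simp only [map_mul, map_pow, Polynomial.C_ofNat]
    ring
  rw [e]
  exact sq_add_four_ne_sq P hP r

/-- Evaluation of the base polynomial `x₁² − P(x₀)x₁ − 1`. -/
theorem eval_hyperellipticFamily_baseMv (x : Fin 2 → ℂ) :
    MvPolynomial.eval x (X 1 ^ 2 - Polynomial.aeval (X 0 : MvPolynomial (Fin 2) ℂ) P * X 1 - 1) =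
      x 1 ^ 2 - P.eval (x 0) * x 1 - 1 := by
  rw [map_sub, map_sub, map_pow, map_mul, MvPolynomial.eval_X, eval_polynomial_aeval_X, map_one]

/-- Evaluation of the fibre function `x₁ − P(x₀) + θ`. -/
theorem eval_hyperellipticFamily_fibreMv (x : Fin 2 → ℂ) :
    MvPolynomial.eval x (X 1 - Polynomial.aeval (X 0 : MvPolynomial (Fin 2) ℂ) P + MvPolynomial.C θ) =
      x 1 - P.eval (x 0) + θ := by
  rw [map_add, map_sub, MvPolynomial.eval_X, eval_polynomial_aeval_X, MvPolynomial.eval_C]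

/-- The base polynomial and its rows. -/
theorem eval_hyperellipticFamily_baseMv_rows (x y : ℂ) :
    MvPolynomial.eval ![x, y] (X 1 ^ 2 - Polynomial.aeval (X 0 : MvPolynomial (Fin 2) ℂ) P * X 1 - 1) =
      ((Polynomial.C (1 : Polynomial ℂ) * Polynomial.X ^ 2 +
        Polynomial.C (-P : Polynomial ℂ) * Polynomial.X + Polynomial.C (-1 : Polynomial ℂ)).map
        (Polynomial.evalRingHom x)).eval y := by
  rw [evalPP_monicQuadratic, eval_hyperellipticFamily_baseMv]
  simp
  ring

/-- The base polynomial is irreducible in `ℂ[x₀, x₁]` (`P` non-constant). [folklore] -/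
theorem irreducible_hyperellipticFamily_baseMv (hP : 1 ≤ P.natDegree) :
    Irreducible (X 1 ^ 2 - Polynomial.aeval (X 0 : MvPolynomial (Fin 2) ℂ) P * X 1 - 1) :=
  (irreducible_rows_iff (eval_hyperellipticFamily_baseMv_rows P)).2
    (irreducible_hyperellipticFamily_baseRow P hP)

/-! ## Part B. The branch at infinity `x₀ = 1/s`, `x₁ = Φ(s)s^{-d}` -/

/-- **The analytic branch of `C_P` at infinity with `x₁ ~ P(x₀)`.**  For `P` of degree `d ≥ 1`
there are `U₀, Φ` analytic at `0` with `Φ(0) = lc(P)`, and for small `s ≠ 0`: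
`P(1/s) = U₀(s)s^{-d}`, `Φ(s) ≠ 0`, and `x₁ = Φ(s)s^{-d}` satisfies `x₁² − P(1/s)x₁ − 1 = 0`.
(`Φ = U₀·(1 + √(1 + 4s^{2d}/U₀²))/2`, principal square root.) [folklore] -/
theorem hyperelliptic_branch_facts (hP : 1 ≤ P.natDegree) :
    ∃ U₀ Φ : ℂ → ℂ, AnalyticAt ℂ U₀ 0 ∧ AnalyticAt ℂ Φ 0 ∧ Φ 0 = P.leadingCoeff ∧
      ∀ᶠ s in 𝓝[≠] (0 : ℂ), P.eval s⁻¹ = U₀ s * (s ^ P.natDegree)⁻¹ ∧ Φ s ≠ 0 ∧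
        (Φ s * (s ^ P.natDegree)⁻¹) ^ 2 - P.eval s⁻¹ * (Φ s * (s ^ P.natDegree)⁻¹) - 1 = 0 := by
  have hP0 : P ≠ 0 := fun h => by rw [h, Polynomial.natDegree_zero] at hP; omega
  have hlc : P.leadingCoeff ≠ 0 := Polynomial.leadingCoeff_ne_zero.2 hP0
  have hd1 : 1 ≤ P.natDegree := hP
  set d := P.natDegree with hd
  obtain ⟨U₀, hUan, hU0eq, hUeval⟩ :=
    exists_polarForm_eval P (U := fun _ : ℂ => (1 : ℂ)) analyticAt_const (k := 1) le_rfl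
  rw [one_pow, mul_one] at hU0eq
  have hU0 : U₀ 0 ≠ 0 := by rw [hU0eq]; exact hlc
  have hPeval : ∀ s : ℂ, s ≠ 0 → P.eval s⁻¹ = U₀ s * (s ^ d)⁻¹ := by
    intro s hs
    have h := hUeval s hs
    rw [one_mul, pow_one, one_mul, inv_pow] at h
    exact h
  -- `w = 4 s^{2d}/U₀²`, `sq = √(1 + w)`, `Φ = U₀ (1 + sq)/2`
  set w : ℂ → ℂ := fun s => 4 * s ^ (2 * d) / U₀ s ^ 2 with hw
  have hwan : AnalyticAt ℂ w 0 :=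
    (analyticAt_const.mul (analyticAt_id.pow (2 * d))).div (hUan.pow 2) (pow_ne_zero _ hU0)
  have hw0 : w 0 = 0 := by
    simp only [hw, zero_pow (by omega : 2 * d ≠ 0), mul_zero, zero_div]
  set sq : ℂ → ℂ := fun s => Complex.exp ((1 / 2 : ℂ) * Complex.log (1 + w s)) with hsq
  have h1wan : AnalyticAt ℂ (fun s => 1 + w s) 0 := analyticAt_const.add hwan
  have hsqan : AnalyticAt ℂ sq 0 :=
    (analyticAt_const.mul (h1wan.clog
      (by show (1 : ℂ) + w 0 ∈ Complex.slitPlane; rw [hw0, add_zero]; exact Complex.one_mem_slitPlane))).cexp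
  have hsq0 : sq 0 = 1 := by simp [hsq, hw0]
  set Φ : ℂ → ℂ := fun s => U₀ s * (1 + sq s) / 2 with hΦ
  have hΦan : AnalyticAt ℂ Φ 0 := (hUan.mul (analyticAt_const.add hsqan)).div_const
  have hΦ0 : Φ 0 = P.leadingCoeff := by
    simp only [hΦ, hsq0, hU0eq]; ring
  have hΦne : ∀ᶠ s in 𝓝 (0 : ℂ), Φ s ≠ 0 := hΦan.continuousAt.eventually_ne (by rw [hΦ0]; exact hlc)
  have hUne : ∀ᶠ s in 𝓝 (0 : ℂ), U₀ s ≠ 0 := hUan.continuousAt.eventually_ne hU0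
  have hsmall : ∀ᶠ s in 𝓝 (0 : ℂ), ‖w s‖ < 1 := by
    have h := hwan.continuousAt.tendsto
    rw [hw0] at h
    have := (Metric.tendsto_nhds.1 h) 1 one_pos
    filter_upwards [this] with s hs
    rwa [dist_zero_right] at hs
  refine ⟨U₀, Φ, hUan, hΦan, hΦ0, ?_⟩
  filter_upwards [self_mem_nhdsWithin, nhdsWithin_le_nhds hΦne, nhdsWithin_le_nhds hUne,
    nhdsWithin_le_nhds hsmall] with s (hs : s ≠ 0) hΦs hUs hws
  refine ⟨hPeval s hs, hΦs, ?_⟩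
  have hslit : 1 + w s ∈ Complex.slitPlane := Complex.mem_slitPlane_of_norm_lt_one hws
  have hne0 : 1 + w s ≠ 0 := Complex.slitPlane_ne_zero hslit
  have hsq2 : sq s ^ 2 = 1 + w s := by
    rw [hsq]
    simp only
    rw [← Complex.exp_nat_mul, ← mul_assoc, show ((2 : ℕ) : ℂ) * (1 / 2 : ℂ) = 1 by norm_num,
      one_mul]
    exact Complex.exp_log hne0
  have hsd : s ^ d ≠ 0 := pow_ne_zero _ hs
  have hw' : w s * U₀ s ^ 2 = 4 * (s ^ d) ^ 2 := by
    rw [hw]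
    simp only
    rw [← pow_mul, mul_comm d 2]
    field_simp
  rw [hPeval s hs, hΦ]
  simp only
  field_simp
  linear_combination (U₀ s ^ 2) * hsq2 + hw'

end Family

end Summit.Schanuel.Schanuel.Theorems
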